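import Literature.AlgebraicGeometry.Resolution.QuasiRegularSequences
import Mathlib.Algebra.MvPolynomial.Equiv
import Mathlib.Algebra.Polynomial.RingDivision
import Mathlib.RingTheory.Nullstellensatz
import Mathlib.RingTheory.Localization.Away.Basic
import Mathlib.RingTheory.Regular.RegularSequence
import Mathlib.RingTheory.Regular.Flat
import Mathlib.Data.Fintype.Lattice
import HarnessLib

/-!
# THREE NON-COLLINEAR POINTS OF THE PLANE ARE A COMPLETE INTERSECTION ON A DISTINGUISHED OPEN
# (W4.5b WIDTH TABLE D3, brick D3-9′ «CI3», desk RULING R40 2026-08-28T18:00:17Z)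

[OURS · L1 W4.5(b) · EL♮(3) stmt-ResolutionOfSingularities-20148 · res-type-027 g20 · helper, `--supports … --as helper`; def-free; pure
`MvPolynomial (Fin 2) k` / `IsLocalization.Away` algebra over an arbitrary field `k`; nothing of the manuscript under review [Hironaka2017] is
asserted and nothing here is a statement of any manuscript; AI-written, weaker than expert review; resolution of singularities in positive
characteristic is NOT proved anywhere in this chain]

WHY.  The Steiner (Roman surface) certificate «Steiner ∈ ν2» of the nose residue (NOSE WORD v1.3 §3 row 1 (b), res-L1-w45b-nose-w3's
`STEINER-TEST.md` (P4)) feeds the UNION `Z′ = L₁′ ⊔ L₂′ ⊔ L₃′` of the three strict-transform lines — the fibres of `Bl_P ℙ³ → ℙ²` over three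
NON-COLLINEAR points `q₁, q₂, q₃` — to a two-chart `DirStepUnobs` producer (res-L1-w45b-nose-w3 ✓ p654480 `dirStepUnobs_of_twoCharts`,
res-L1-w45b-nose-w1 ✓ p655133 `dirStepUnobs_univ_of_charts`), which wants the ideal of `Z′` generated on each host chart by `n − 1 = 2`
global quasi-regular equations.  Three non-collinear points of `𝔸²` are NOT a global complete intersection (`μ = 3`), but they ARE one on a
distinguished open `D(ℓ) ∋ q₁, q₂, q₃`: this file supplies the equations, the localising element and the ring-level facts, for the normalised
triple `(0,0), (1,0), (0,1)` (the consumer moves the three Steiner directions there by a linear change of the plane chart, desk R40 (1)).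

WHAT (all INLINE, no definitions; `x = X 0`, `y = X 1`):  `f := X 0 * (X 0 - 1)` (`= x(x−1)`), `g := X 1 * (X 1 - 1 + 2 * X 0)` (`= y(y−1+2x)`),
`ℓ := X 1 + 1 + C c * (X 0 - 1)` (`= y + 1 + c(x − 1)`, a parameter `c : k`).  `V(f, g) = {(0,0), (0,1), (1,0), (1,−1)}` in EVERY
characteristic (`g(0,y) = y(y−1)`, `g(1,y) = y(y+1)`); the spurious fourth point `(1,−1)` lies on `V(ℓ)`, and `ℓ(0,0) = 1 − c`, `ℓ(1,0) = 1`,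
`ℓ(0,1) = 2 − c`, so `ℓ` misses the three points iff `c ≠ 1 ∧ c ≠ 2` (`c = 0` off characteristic `2`; any `c ∉ {0,1}` in characteristic `2`;
`exists_good_c` for infinite `k`).
* §1–§2 `exists_eq_mul_of_eval_eq_zero_two` (one variable: two roots ⇒ multiple of the product, via Mathlib `MvPolynomial.uniqueAlgEquiv`) and
  ★ `mem_span_of_eval_eq_zero` — **`(f, g)` IS THE IDEAL OF THE FOUR REDUCED POINTS**: `h(0,0) = h(1,0) = h(0,1) = h(1,−1) = 0 ⇒ h ∈ (f, g)`
  (write `k[x,y] = k[y][x]` by Mathlib `finSuccEquiv k 1`, reduce `h` along `x ↦ 0, 1`, divide by `y(y−1)` / `y(y+1)`, correct by a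
  multiple of `g`, then `x(x−1) ∣` the remainder by coprimality of `x`, `x − 1`);
* §3 `eval_f_eq_zero`, `eval_g_eq_zero`, `eval_ell_ne_zero`, `eval_ell_spurious`, ★ `eq_of_eval_eq_zero` (the common zeros of `f`, `g` off
  `V(ℓ)` are exactly the three points);
* §4 ★★ `map_span_eq_map_inf_vanishingIdeal` — **in any localisation `S` of `k[x,y]` away from `ℓ`, `(f, g)·S = (𝔪_{(0,0)} ∩ 𝔪_{(1,0)} ∩ 𝔪_{(0,1)})·S`**
  (`𝔪_q = MvPolynomial.vanishingIdeal k {q}`; for `h` in the triple intersection `h·ℓ` vanishes at the four points);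
* §5 `dvd_of_dvd_mul_g`, ★ `isWeaklyRegular_fg` (`[f, g]` is a regular sequence on `k[x,y]`) and `isQuasiRegular_fg` (tree
  `isQuasiRegular_of_isWeaklyRegular`, Matsumura 16.2 (i)) — the quasi-regularity the producers consume (after the consumer's flat base
  change to its chart ring).

References: H. Matsumura, *Commutative Ring Theory* (1986), Thm. 16.2 (i) [Matsumura1987]; R. Hartshorne, *Algebraic Geometry* (1977),
I Ex. 2.17 / II Ex. 8.4 (complete intersections; context) [Hartshorne1977].
-/

set_option linter.dupNamespace false

noncomputable section

open MvPolynomial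

namespace Summit.ResolutionOfSingularities.ResolutionOfSingularities.Cruxes.EquisingularLiftNat.Sections.ThreePointsCI

variable {k : Type} [Field k]

/-! ## §1 One variable: a polynomial with two prescribed roots is a multiple of the product -/

/-- Evaluation through the one-variable identification `k[X₀] ≅ k[T]`. [folklore] -/
theorem polynomial_eval_uniqueAlgEquiv (b : k) (P : MvPolynomial (Fin 1) k) :
    Polynomial.eval b (MvPolynomial.uniqueAlgEquiv k (Fin 1) P) = eval (fun _ => b) P := by
  have h : (Polynomial.evalRingHom b).comp (MvPolynomial.uniqueAlgEquiv k (Fin 1)).toRingEquiv.toRingHom =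
      eval (fun _ => b) := by
    apply MvPolynomial.ringHom_ext
    · intro a; simp [MvPolynomial.uniqueAlgEquiv_apply]
    · intro i; simp [MvPolynomial.uniqueAlgEquiv_apply]
  exact RingHom.congr_fun h P

/-- `Ψ (X 0) = T`. [folklore] -/
theorem uniqueAlgEquiv_X_zero : MvPolynomial.uniqueAlgEquiv k (Fin 1) (X 0) = Polynomial.X := by
  simp [MvPolynomial.uniqueAlgEquiv_apply]

/-- **Two roots ⇒ multiple of the product** in `k[X₀] = MvPolynomial (Fin 1) k`: if `P(b₁) = P(b₂) = 0` with `b₁ ≠ b₂` then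
`P = (X₀ − b₁)(X₀ − b₂)·a`. [folklore] -/
theorem exists_eq_mul_of_eval_eq_zero_two {b₁ b₂ : k} (hb : b₁ ≠ b₂) (P : MvPolynomial (Fin 1) k)
    (h₁ : eval (fun _ => b₁) P = 0) (h₂ : eval (fun _ => b₂) P = 0) :
    ∃ a : MvPolynomial (Fin 1) k, P = (X 0 - C b₁) * (X 0 - C b₂) * a := by
  set Ψ := MvPolynomial.uniqueAlgEquiv k (Fin 1) with hΨ
  have hr₁ : (Ψ P).IsRoot b₁ := by rw [Polynomial.IsRoot, polynomial_eval_uniqueAlgEquiv, h₁]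
  have hr₂ : (Ψ P).IsRoot b₂ := by rw [Polynomial.IsRoot, polynomial_eval_uniqueAlgEquiv, h₂]
  have hd₁ : Polynomial.X - Polynomial.C b₁ ∣ Ψ P := Polynomial.dvd_iff_isRoot.mpr hr₁
  have hd₂ : Polynomial.X - Polynomial.C b₂ ∣ Ψ P := Polynomial.dvd_iff_isRoot.mpr hr₂
  have hcop : IsCoprime (Polynomial.X - Polynomial.C b₁) (Polynomial.X - Polynomial.C b₂) :=
    Polynomial.isCoprime_X_sub_C_of_isUnit_sub (sub_ne_zero.mpr hb).isUnit
  obtain ⟨A, hA⟩ := hcop.mul_dvd hd₁ hd₂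
  refine ⟨Ψ.symm A, ?_⟩
  apply Ψ.injective
  have hC : ∀ b : k, Ψ (C b) = Polynomial.C b := fun b => by
    rw [← MvPolynomial.algebraMap_eq, AlgEquiv.commutes, Polynomial.algebraMap_eq]
  rw [hA, map_mul, map_mul, AlgEquiv.apply_symm_apply, map_sub, map_sub, uniqueAlgEquiv_X_zero, hC, hC]

/-- `![b] = fun _ => b` on `Fin 1`. [folklore] -/
theorem vec1_eq_const {α : Type*} (b : α) : (![b] : Fin 1 → α) = fun _ => b := by
  funext i; fin_cases i; rfl

/-! ## §2 Two variables: `k[X₀, X₁] = k[X₁][T]`, `T = X₀` (Mathlib `finSuccEquiv k 1`) -/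

/-- `E (X 1) = C (X 0)`. [folklore] -/
theorem finSuccEquiv_X_one : finSuccEquiv k 1 (X 1 : MvPolynomial (Fin 2) k) = Polynomial.C (X 0) :=
  finSuccEquiv_X_succ (j := (0 : Fin 1))

/-- Point evaluation through `E`: `h(a, b) = ((E h) with coefficients evaluated at `b`) (a)`. [folklore] -/
theorem eval_vec2 (a b : k) (h : MvPolynomial (Fin 2) k) :
    eval ![a, b] h = Polynomial.eval a (Polynomial.map (eval ![b]) (finSuccEquiv k 1 h)) :=
  eval_eq_eval_mv_eval' ![b] a h

/-- `h(0, b) = (E h)(0)` evaluated at `b`. [folklore] -/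
theorem eval_vec2_zero (b : k) (h : MvPolynomial (Fin 2) k) :
    eval ![0, b] h = eval ![b] (Polynomial.eval 0 (finSuccEquiv k 1 h)) := by
  rw [eval_vec2, Polynomial.eval_zero_map]

/-- `h(1, b) = (E h)(1)` evaluated at `b`. [folklore] -/
theorem eval_vec2_one (b : k) (h : MvPolynomial (Fin 2) k) :
    eval ![1, b] h = eval ![b] (Polynomial.eval 1 (finSuccEquiv k 1 h)) := by
  rw [eval_vec2, Polynomial.eval_one_map]

/-- Over any commutative ring: a polynomial vanishing at `0` and `1` is a multiple of `T(T − 1)`. [folklore] -/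
theorem exists_eq_X_mul_X_sub_one_mul {A : Type*} [CommRing A] (H : Polynomial A) (h0 : Polynomial.eval 0 H = 0)
    (h1 : Polynomial.eval 1 H = 0) : ∃ W : Polynomial A, H = Polynomial.X * (Polynomial.X - 1) * W := by
  have hd0 : Polynomial.X - Polynomial.C (0 : A) ∣ H := Polynomial.dvd_iff_isRoot.mpr h0
  have hd1 : Polynomial.X - Polynomial.C (1 : A) ∣ H := Polynomial.dvd_iff_isRoot.mpr h1
  have hcop : IsCoprime (Polynomial.X - Polynomial.C (0 : A)) (Polynomial.X - Polynomial.C (1 : A)) :=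
    Polynomial.isCoprime_X_sub_C_of_isUnit_sub (by rw [zero_sub]; exact isUnit_one.neg)
  obtain ⟨W, hW⟩ := hcop.mul_dvd hd0 hd1
  refine ⟨W, ?_⟩
  rw [hW, map_zero, sub_zero, map_one]

/-- **`(f, g)` is the ideal of the four points**: a polynomial vanishing at `(0,0)`, `(1,0)`, `(0,1)`, `(1,−1)` lies in
`(X₀(X₀ − 1), X₁(X₁ − 1 + 2X₀))` (reduce along `X₀ ↦ 0`, `X₀ ↦ 1` to `k[X₁]`, where `g` becomes `X₁(X₁ − 1)`, `X₁(X₁ + 1)`). [folklore] -/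
theorem mem_span_of_eval_eq_zero (h : MvPolynomial (Fin 2) k)
    (h00 : eval ![0, 0] h = 0) (h10 : eval ![1, 0] h = 0) (h01 : eval ![0, 1] h = 0) (h1m : eval ![1, -1] h = 0) :
    h ∈ Ideal.span ({X 0 * (X 0 - 1), X 1 * (X 1 - 1 + 2 * X 0)} : Set (MvPolynomial (Fin 2) k)) := by
  set E := finSuccEquiv k 1 with hE
  set H := E h with hH
  -- the two reductions `P₀ = h(0, ·)`, `P₁ = h(1, ·)` and their roots
  set P₀ : MvPolynomial (Fin 1) k := Polynomial.eval 0 H with hP₀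
  set P₁ : MvPolynomial (Fin 1) k := Polynomial.eval 1 H with hP₁
  have hP₀0 : eval (fun _ => (0 : k)) P₀ = 0 := by rw [← vec1_eq_const, hP₀, hH, hE, ← eval_vec2_zero, h00]
  have hP₀1 : eval (fun _ => (1 : k)) P₀ = 0 := by rw [← vec1_eq_const, hP₀, hH, hE, ← eval_vec2_zero, h01]
  have hP₁0 : eval (fun _ => (0 : k)) P₁ = 0 := by rw [← vec1_eq_const, hP₁, hH, hE, ← eval_vec2_one, h10]
  have hP₁m : eval (fun _ => (-1 : k)) P₁ = 0 := by rw [← vec1_eq_const, hP₁, hH, hE, ← eval_vec2_one, h1m]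
  obtain ⟨a₀, ha₀⟩ := exists_eq_mul_of_eval_eq_zero_two (zero_ne_one : (0 : k) ≠ 1) P₀ hP₀0 hP₀1
  obtain ⟨a₁, ha₁⟩ := exists_eq_mul_of_eval_eq_zero_two (show (0 : k) ≠ -1 by norm_num) P₁ hP₁0 hP₁m
  -- `E g`
  have hEg : E (X 1 * (X 1 - 1 + 2 * X 0)) = Polynomial.C (X 0) * (Polynomial.C (X 0) - 1 + 2 * Polynomial.X) := by
    rw [map_mul, map_add, map_sub, map_mul, hE, finSuccEquiv_X_one, finSuccEquiv_X_zero, map_one, map_ofNat]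
  -- the correction `Q` with `Q(0) = a₀`, `Q(1) = a₁`
  set Q : Polynomial (MvPolynomial (Fin 1) k) := Polynomial.C a₀ + Polynomial.C (a₁ - a₀) * Polynomial.X with hQ
  have hH'0 : Polynomial.eval 0 (H - E (X 1 * (X 1 - 1 + 2 * X 0)) * Q) = 0 := by
    rw [Polynomial.eval_sub, Polynomial.eval_mul, ← hP₀, ha₀, hEg, hQ]
    simp only [Polynomial.eval_mul, Polynomial.eval_add, Polynomial.eval_sub, Polynomial.eval_C, Polynomial.eval_X,
      Polynomial.eval_one, Polynomial.eval_ofNat, map_zero, map_one]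
    ring
  have hH'1 : Polynomial.eval 1 (H - E (X 1 * (X 1 - 1 + 2 * X 0)) * Q) = 0 := by
    rw [Polynomial.eval_sub, Polynomial.eval_mul, ← hP₁, ha₁, hEg, hQ]
    simp only [Polynomial.eval_mul, Polynomial.eval_add, Polynomial.eval_sub, Polynomial.eval_C, Polynomial.eval_X,
      Polynomial.eval_one, Polynomial.eval_ofNat, map_zero, map_one, map_neg]
    ring
  obtain ⟨W, hW⟩ := exists_eq_X_mul_X_sub_one_mul _ hH'0 hH'1
  -- back through `E⁻¹`
  have hEX : E.symm Polynomial.X = X 0 := by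
    rw [← finSuccEquiv_X_zero (R := k) (n := 1), ← hE, AlgEquiv.symm_apply_apply]
  have hdecomp : h = E.symm W * (X 0 * (X 0 - 1)) + E.symm Q * (X 1 * (X 1 - 1 + 2 * X 0)) := by
    apply E.injective
    have e1 : E (E.symm W * (X 0 * (X 0 - 1))) = W * (Polynomial.X * (Polynomial.X - 1)) := by
      rw [map_mul, AlgEquiv.apply_symm_apply, map_mul, map_sub, map_one, ← hEX, AlgEquiv.apply_symm_apply]
    have e2 : E (E.symm Q * (X 1 * (X 1 - 1 + 2 * X 0))) = Q * E (X 1 * (X 1 - 1 + 2 * X 0)) := by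
      rw [map_mul, AlgEquiv.apply_symm_apply]
    rw [map_add, e1, e2, ← hH]
    rw [sub_eq_iff_eq_add] at hW
    rw [hW]
    ring
  rw [hdecomp]
  exact Ideal.add_mem _ (Ideal.mul_mem_left _ _ (Ideal.subset_span (by simp)))
    (Ideal.mul_mem_left _ _ (Ideal.subset_span (by simp)))

/-! ## §3 The three points, the equations `f = X₀(X₀ − 1)`, `g = X₁(X₁ − 1 + 2X₀)` and the localising element `ℓ = X₁ + 1 + c(X₀ − 1)` -/

/-- `f` vanishes at the three points. [folklore] -/
theorem eval_f_eq_zero (q : Fin 2 → k) (hq : q = ![0, 0] ∨ q = ![1, 0] ∨ q = ![0, 1]) :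
    eval q (X 0 * (X 0 - 1) : MvPolynomial (Fin 2) k) = 0 := by
  rcases hq with rfl | rfl | rfl <;> simp

/-- `g` vanishes at the three points. [folklore] -/
theorem eval_g_eq_zero (q : Fin 2 → k) (hq : q = ![0, 0] ∨ q = ![1, 0] ∨ q = ![0, 1]) :
    eval q (X 1 * (X 1 - 1 + 2 * X 0) : MvPolynomial (Fin 2) k) = 0 := by
  rcases hq with rfl | rfl | rfl <;> simp

/-- `ℓ = X₁ + 1 + c(X₀ − 1)` takes the values `1 − c`, `1`, `2 − c` at the three points, hence does not vanish there when `c ≠ 1`,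
`c ≠ 2` (`c = 0` in characteristic `≠ 2`; any `c ∉ {0, 1}` in characteristic `2`). [folklore] -/
theorem eval_ell_ne_zero (c : k) (hc1 : c ≠ 1) (hc2 : c ≠ 2) (q : Fin 2 → k) (hq : q = ![0, 0] ∨ q = ![1, 0] ∨ q = ![0, 1]) :
    eval q (X 1 + 1 + C c * (X 0 - 1) : MvPolynomial (Fin 2) k) ≠ 0 := by
  rcases hq with rfl | rfl | rfl
  · simp only [map_add, map_mul, map_sub, eval_X, eval_C, map_one, Matrix.cons_val_one, Matrix.cons_val_zero]
    intro h; apply hc1; linear_combination -h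
  · simp [map_add, map_mul, map_sub, eval_X, eval_C, map_one]
  · simp only [map_add, map_mul, map_sub, eval_X, eval_C, map_one, Matrix.cons_val_one, Matrix.cons_val_zero]
    intro h; apply hc2; linear_combination -h

/-- `ℓ` vanishes at the fourth common zero `(1, −1)` of `f` and `g` (in every characteristic). [folklore] -/
theorem eval_ell_spurious (c : k) : eval ![1, -1] (X 1 + 1 + C c * (X 0 - 1) : MvPolynomial (Fin 2) k) = 0 := by
  simp

/-- **The common zeros of `f` and `g` off `V(ℓ)` are exactly the three points.** [folklore] -/
theorem eq_of_eval_eq_zero (c : k) (a : Fin 2 → k)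
    (hf : eval a (X 0 * (X 0 - 1) : MvPolynomial (Fin 2) k) = 0)
    (hg : eval a (X 1 * (X 1 - 1 + 2 * X 0) : MvPolynomial (Fin 2) k) = 0)
    (hℓ : eval a (X 1 + 1 + C c * (X 0 - 1) : MvPolynomial (Fin 2) k) ≠ 0) :
    a = ![0, 0] ∨ a = ![1, 0] ∨ a = ![0, 1] := by
  have ha : a = ![a 0, a 1] := by ext i; fin_cases i <;> rfl
  simp only [map_mul, map_sub, map_add, eval_X, eval_C, map_one, map_ofNat] at hf hg hℓ
  rcases mul_eq_zero.mp hf with h0 | h0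
  · -- `a 0 = 0`: then `a 1 (a 1 - 1) = 0`
    rw [h0] at hg
    rcases mul_eq_zero.mp hg with h1 | h1
    · left; rw [ha, h0, h1]
    · right; right; rw [ha, h0, show a 1 = 1 by linear_combination h1]
  · -- `a 0 = 1`: then `a 1 (a 1 + 1) = 0`, and `a 1 = -1` is excluded by `ℓ`
    have h0' : a 0 = 1 := by linear_combination h0
    rw [h0'] at hg hℓ
    rcases mul_eq_zero.mp hg with h1 | h1
    · right; left; rw [ha, h0', h1]
    · exfalso; apply hℓ
      have h1' : a 1 = -1 := by linear_combination h1
      rw [h1']; simp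

/-- Over an infinite field there is a good parameter `c ∉ {1, 2}`. [folklore] -/
theorem exists_good_c [Infinite k] : ∃ c : k, c ≠ 1 ∧ c ≠ 2 := by
  classical
  obtain ⟨c, hc⟩ := Infinite.exists_notMem_finset ({1, 2} : Finset k)
  simp only [Finset.mem_insert, Finset.mem_singleton, not_or] at hc
  exact ⟨c, hc.1, hc.2⟩

/-! ## §4 Complete intersection on `D(ℓ)` -/

/-- `(f, g) ⊆ 𝔪_q` for each of the three points. [folklore] -/
theorem span_le_vanishingIdeal (q : Fin 2 → k) (hq : q = ![0, 0] ∨ q = ![1, 0] ∨ q = ![0, 1]) :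
    Ideal.span ({X 0 * (X 0 - 1), X 1 * (X 1 - 1 + 2 * X 0)} : Set (MvPolynomial (Fin 2) k)) ≤
      MvPolynomial.vanishingIdeal k {q} := by
  rw [Ideal.span_le]
  rintro p hp
  simp only [Set.mem_insert_iff, Set.mem_singleton_iff] at hp
  rw [SetLike.mem_coe, MvPolynomial.mem_vanishingIdeal_singleton_iff, MvPolynomial.aeval_eq_eval]
  rcases hp with rfl | rfl
  · exact eval_f_eq_zero q hq
  · exact eval_g_eq_zero q hq

/-- **COMPLETE INTERSECTION ON `D(ℓ)`.** In any localisation `S = k[X₀,X₁][1/ℓ]` the ideal `(f, g)` is the ideal of the three points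
`𝔪_{(0,0)} ∩ 𝔪_{(1,0)} ∩ 𝔪_{(0,1)}` (`𝔪_q = MvPolynomial.vanishingIdeal k {q}`): for `h` in the triple intersection, `h·ℓ` vanishes at the
four common zeros of `f`, `g`, so `h·ℓ ∈ (f, g)` and `ℓ` is a unit of `S`. [folklore] -/
theorem map_span_eq_map_inf_vanishingIdeal (c : k) {S : Type*} [CommRing S] [Algebra (MvPolynomial (Fin 2) k) S]
    [IsLocalization.Away (X 1 + 1 + C c * (X 0 - 1) : MvPolynomial (Fin 2) k) S] :
    (Ideal.span ({X 0 * (X 0 - 1), X 1 * (X 1 - 1 + 2 * X 0)} : Set (MvPolynomial (Fin 2) k))).map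
        (algebraMap (MvPolynomial (Fin 2) k) S) =
      ((MvPolynomial.vanishingIdeal k {(![0, 0] : Fin 2 → k)} ⊓ MvPolynomial.vanishingIdeal k {(![1, 0] : Fin 2 → k)}) ⊓
        MvPolynomial.vanishingIdeal k {(![0, 1] : Fin 2 → k)}).map (algebraMap (MvPolynomial (Fin 2) k) S) := by
  apply le_antisymm
  · apply Ideal.map_mono
    exact le_inf (le_inf (span_le_vanishingIdeal _ (Or.inl rfl)) (span_le_vanishingIdeal _ (Or.inr (Or.inl rfl))))
      (span_le_vanishingIdeal _ (Or.inr (Or.inr rfl)))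
  · rw [Ideal.map_le_iff_le_comap]
    intro h hh
    rw [Submodule.mem_inf, Submodule.mem_inf] at hh
    obtain ⟨⟨h00, h10⟩, h01⟩ := hh
    rw [MvPolynomial.mem_vanishingIdeal_singleton_iff, MvPolynomial.aeval_eq_eval] at h00 h10 h01
    -- `h·ℓ ∈ (f, g)`
    have hℓ : h * (X 1 + 1 + C c * (X 0 - 1)) ∈
        Ideal.span ({X 0 * (X 0 - 1), X 1 * (X 1 - 1 + 2 * X 0)} : Set (MvPolynomial (Fin 2) k)) := by
      apply mem_span_of_eval_eq_zero
      · change eval ![0, 0] (h * _) = 0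
        rw [map_mul, show eval ![0, 0] h = 0 from h00, zero_mul]
      · change eval ![1, 0] (h * _) = 0
        rw [map_mul, show eval ![1, 0] h = 0 from h10, zero_mul]
      · change eval ![0, 1] (h * _) = 0
        rw [map_mul, show eval ![0, 1] h = 0 from h01, zero_mul]
      · rw [map_mul, eval_ell_spurious, mul_zero]
    -- `ℓ` is a unit in `S`
    obtain ⟨u, hu⟩ := IsLocalization.Away.algebraMap_isUnit (S := S) (X 1 + 1 + C c * (X 0 - 1) : MvPolynomial (Fin 2) k)
    rw [Ideal.mem_comap]
    have hmem := Ideal.mem_map_of_mem (algebraMap (MvPolynomial (Fin 2) k) S) hℓ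
    rw [map_mul, ← hu] at hmem
    have := Ideal.mul_mem_right (↑u⁻¹ : S) _ hmem
    rwa [mul_assoc, Units.mul_inv, mul_one] at this

/-! ## §5 `(f, g)` is a regular sequence on `k[X₀, X₁]` -/

/-- `X₀(X₀ − 1) ≠ 0` and `X₀(X₀ + 1) ≠ 0` in `k[X₀]`. [folklore] -/
theorem X_mul_ne_zero (b : k) : (X 0 * (X 0 - C b) : MvPolynomial (Fin 1) k) ≠ 0 := by
  refine mul_ne_zero (X_ne_zero _) fun h => ?_
  have := congrArg (eval fun _ => b + 1) h
  simp at this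

/-- **`g` is a non-zero-divisor modulo `f`**: `f ∣ g·u ⇒ f ∣ u`. [folklore] -/
theorem dvd_of_dvd_mul_g {u v : MvPolynomial (Fin 2) k} (huv : (X 1 * (X 1 - 1 + 2 * X 0)) * u = (X 0 * (X 0 - 1)) * v) :
    ∃ w, u = (X 0 * (X 0 - 1)) * w := by
  set E := finSuccEquiv k 1 with hE
  have hEg : E (X 1 * (X 1 - 1 + 2 * X 0)) = Polynomial.C (X 0) * (Polynomial.C (X 0) - 1 + 2 * Polynomial.X) := by
    rw [map_mul, map_add, map_sub, map_mul, hE, finSuccEquiv_X_one, finSuccEquiv_X_zero, map_one, map_ofNat]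
  have hEf : E (X 0 * (X 0 - 1)) = Polynomial.X * (Polynomial.X - 1) := by
    rw [map_mul, map_sub, hE, finSuccEquiv_X_zero, map_one]
  have hEq : E (X 1 * (X 1 - 1 + 2 * X 0)) * E u = E (X 0 * (X 0 - 1)) * E v := by
    rw [← map_mul, ← map_mul, huv]
  rw [hEg, hEf] at hEq
  -- evaluate at `T = 0` and `T = 1`
  have h0 := congrArg (Polynomial.eval 0) hEq
  have h1 := congrArg (Polynomial.eval 1) hEq
  simp only [Polynomial.eval_mul, Polynomial.eval_add, Polynomial.eval_sub, Polynomial.eval_C, Polynomial.eval_X,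
    Polynomial.eval_one, Polynomial.eval_ofNat, mul_zero, add_zero, zero_mul, sub_self, mul_one, zero_sub] at h0 h1
  have hu0 : Polynomial.eval 0 (E u) = 0 := by
    have hne : (X 0 * (X 0 - 1) : MvPolynomial (Fin 1) k) ≠ 0 := by
      have := X_mul_ne_zero (k := k) 1; rwa [map_one] at this
    exact (mul_eq_zero.mp h0).resolve_left hne
  have hu1 : Polynomial.eval 1 (E u) = 0 := by
    have hne : (X 0 * (X 0 - 1 + 2) : MvPolynomial (Fin 1) k) ≠ 0 := by
      have := X_mul_ne_zero (k := k) (-1)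
      rwa [map_neg, map_one, sub_neg_eq_add, show (X 0 - 1 + 2 : MvPolynomial (Fin 1) k) = X 0 + 1 by ring] at *
    rcases mul_eq_zero.mp h1 with h | h
    · exact absurd h hne
    · exact h
  obtain ⟨W, hW⟩ := exists_eq_X_mul_X_sub_one_mul _ hu0 hu1
  refine ⟨E.symm W, E.injective ?_⟩
  rw [map_mul, hEf, AlgEquiv.apply_symm_apply, hW]

/-- **`(f, g)` is a (weakly) regular sequence on `k[X₀, X₁]`.** [folklore] -/
theorem isWeaklyRegular_fg :
    RingTheory.Sequence.IsWeaklyRegular (MvPolynomial (Fin 2) k)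
      [(X 0 * (X 0 - 1) : MvPolynomial (Fin 2) k), X 1 * (X 1 - 1 + 2 * X 0)] := by
  rw [RingTheory.Sequence.isWeaklyRegular_cons_iff, RingTheory.Sequence.isWeaklyRegular_singleton_iff]
  constructor
  · -- `f` is a non-zero-divisor
    have hf0 : (X 0 * (X 0 - 1) : MvPolynomial (Fin 2) k) ≠ 0 := by
      refine mul_ne_zero (X_ne_zero _) fun h => ?_
      have := congrArg (eval ![0, 0]) h
      simp at this
    exact (IsRegular.of_ne_zero hf0).left.isSMulRegular
  · -- `g` is regular on `k[X]/(f)`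
    rw [isSMulRegular_quotient_iff_mem_of_smul_mem]
    intro u hu
    rw [Submodule.mem_smul_pointwise_iff_exists] at hu ⊢
    obtain ⟨v, -, hv⟩ := hu
    rw [smul_eq_mul, smul_eq_mul] at hv
    obtain ⟨w, hw⟩ := dvd_of_dvd_mul_g hv.symm
    exact ⟨w, Submodule.mem_top, by rw [smul_eq_mul, hw]⟩

/-- … hence QUASI-REGULAR (Matsumura 16.2 (i), tree `isQuasiRegular_of_isWeaklyRegular`); quasi-regularity is what the `DirStepUnobs`
producers (`dirStepUnobs_of_twoCharts`, `dirStepUnobs_univ_of_charts`) consume, after the consumer's flat base change to its chart ring.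
[cite: Matsumura1987, Thm. 16.2 (i)] -/
theorem isQuasiRegular_fg :
    Literature.AlgebraicGeometry.Resolution.IsQuasiRegular
      (![(X 0 * (X 0 - 1) : MvPolynomial (Fin 2) k), X 1 * (X 1 - 1 + 2 * X 0)]) := by
  apply Literature.AlgebraicGeometry.Resolution.isQuasiRegular_of_isWeaklyRegular
  have h : List.ofFn ![(X 0 * (X 0 - 1) : MvPolynomial (Fin 2) k), X 1 * (X 1 - 1 + 2 * X 0)] =
      [(X 0 * (X 0 - 1) : MvPolynomial (Fin 2) k), X 1 * (X 1 - 1 + 2 * X 0)] := by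
    simp [List.ofFn_succ]
  rw [h]
  exact isWeaklyRegular_fg

/-! ## §6 (append) Flat base change to the consumer's chart ring -/

/-- **`(f, g)` stays a regular sequence in every FLAT `k[X₀,X₁]`-algebra `S`** (a localisation `k[x,y]_ℓ`, a chart ring `k[x,y]_ℓ[t]`, …;
Mathlib `RingTheory.Sequence.IsWeaklyRegular.of_flat`). [cite: Matsumura1987, Thm. 16.2 (i) (context)] -/
theorem isWeaklyRegular_fg_of_flat (S : Type*) [CommRing S] [Algebra (MvPolynomial (Fin 2) k) S]
    [Module.Flat (MvPolynomial (Fin 2) k) S] :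
    RingTheory.Sequence.IsWeaklyRegular S
      [algebraMap (MvPolynomial (Fin 2) k) S (X 0 * (X 0 - 1)), algebraMap (MvPolynomial (Fin 2) k) S (X 1 * (X 1 - 1 + 2 * X 0))] := by
  have h := (isWeaklyRegular_fg (k := k)).of_flat (S := S)
  simpa only [List.map_cons, List.map_nil] using h

/-- … hence QUASI-REGULAR there — the `hqr` input of the `DirStepUnobs` producers in the consumer's chart ring. [cite: Matsumura1987, Thm. 16.2 (i)] -/
theorem isQuasiRegular_fg_of_flat (S : Type*) [CommRing S] [Algebra (MvPolynomial (Fin 2) k) S]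
    [Module.Flat (MvPolynomial (Fin 2) k) S] :
    Literature.AlgebraicGeometry.Resolution.IsQuasiRegular
      (![algebraMap (MvPolynomial (Fin 2) k) S (X 0 * (X 0 - 1)), algebraMap (MvPolynomial (Fin 2) k) S (X 1 * (X 1 - 1 + 2 * X 0))]) := by
  apply Literature.AlgebraicGeometry.Resolution.isQuasiRegular_of_isWeaklyRegular
  have h : List.ofFn ![algebraMap (MvPolynomial (Fin 2) k) S (X 0 * (X 0 - 1)),
      algebraMap (MvPolynomial (Fin 2) k) S (X 1 * (X 1 - 1 + 2 * X 0))] =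
      [algebraMap (MvPolynomial (Fin 2) k) S (X 0 * (X 0 - 1)), algebraMap (MvPolynomial (Fin 2) k) S (X 1 * (X 1 - 1 + 2 * X 0))] := by
    simp [List.ofFn_succ]
  rw [h]
  exact isWeaklyRegular_fg_of_flat S

/-- In particular in any localisation away from `ℓ` (flat over `k[x,y]`). [cite: Matsumura1987, Thm. 16.2 (i) (context)] -/
theorem isQuasiRegular_fg_away (c : k) (S : Type*) [CommRing S] [Algebra (MvPolynomial (Fin 2) k) S]
    [IsLocalization.Away (X 1 + 1 + C c * (X 0 - 1) : MvPolynomial (Fin 2) k) S] :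
    Literature.AlgebraicGeometry.Resolution.IsQuasiRegular
      (![algebraMap (MvPolynomial (Fin 2) k) S (X 0 * (X 0 - 1)), algebraMap (MvPolynomial (Fin 2) k) S (X 1 * (X 1 - 1 + 2 * X 0))]) := by
  haveI : Module.Flat (MvPolynomial (Fin 2) k) S :=
    IsLocalization.flat S (Submonoid.powers (X 1 + 1 + C c * (X 0 - 1) : MvPolynomial (Fin 2) k))
  exact isQuasiRegular_fg_of_flat S

end Summit.ResolutionOfSingularities.ResolutionOfSingularities.Cruxes.EquisingularLiftNat.Sections.ThreePointsCI

end
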